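import Literature.NumberTheory.Sieve.LargestPrimeFactorCubicMertensWindows
import Literature.NumberTheory.Sieve.LargestPrimeFactorCubicSetup
import HarnessLib

/-!
# Heath-Brown 2001 (PLMS), (6.3) and Lemma 8: the windows `𝒦` and `q1Range × q2Range` of the
# parallel seat's `…Setup`, and their limits `log 4/3` and `L(δ)`

Topic `Literature/NumberTheory/Sieve`; a PROVED bookkeeping layer (no named facts) under the named fact
`Irving2015_largestPrimeFactor_cubic` (`LargestPrimeFactorCubic.lean`), joining `…MertensWindows`
(`tendsto_sum_g_window_63`, `tendsto_L`, stated for real `x` and windows `(primesLE ⌊x^β⌋).filter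
(x^α < ·)`) with the finite sets `kPrimes X`, `q1Range X`, `q2Range X` of `…Setup` (stated with
`Finset.Ioc` of floors).  Source: D. R. Heath-Brown, *The largest prime factor of `X³ + 2`*, Proc. London
Math. Soc. (3) 82 (2001) 554–596: (6.3) "`∑_{K∈𝒦} ρ(K)/N(K) = log log X^{4δ} − log log X^{3δ} + o(1) =
log(4/3) + o(1)`" and §8 p. 31 "`∑_{q₁,q₂} ν(q₁)ν(q₂)/(q₁q₂) = L(δ) + o(1)`", `L(δ) = (log(1 +
7δ/5))(log(1 + 7δ/6))` (Lemma 8), `ν(p)/p = g(p)/(p + 1)`.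

PROVED here: `kPrimes_eq_window`, `q1Range_eq_window`, `q2Range_eq_window` (set identities; the generic
`Ioc`/`primesLE` identity is the tree's `SiegelZero.Ioc_filter_prime_eq_primesLE_filter`, inlined here),
`tendsto_Npar` (`N = X^{(1+2δ)/3} → ∞`), **`tendsto_sum_kPrimes`**
(`∑_{p∈𝒦} g(p)/p → log 4/3`) and **`tendsto_L_ranges`**
(`(∑_{q₁∈q1Range} g(q₁)/(q₁+1)) (∑_{q₂∈q2Range} g(q₂)/(q₂+1)) → L(1/321)`), as `X → ∞` through `ℕ`.

## References

* D. R. Heath-Brown, *The largest prime factor of `X³ + 2`*, Proc. London Math. Soc. (3) 82 (2001)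
  554–596, (6.3) p. 22, Lemma 8 p. 11, §8 p. 31. [`HeathBrown2001LargestPrimeFactorCubic`]

## Mathlib / tree search

Tree: `tendsto_sum_g_window_63`, `tendsto_L` (`…MertensWindows`), `kPrimes`, `q1Range`, `q2Range`, `Npar`,
`hbδ`, `hbδ_pos` (`…Setup`), `CubicPrimes.cubeRootTwoCount`.  Mathlib: `Nat.mem_primesLE`, `Nat.floor_lt`,
`tendsto_natCast_atTop_atTop`, `tendsto_rpow_atTop`, `Filter.Tendsto.comp`.
-/

noncomputable section

open Finset Filter Topology Real

namespace Literature.NumberTheory.Sieve.HeathBrown2001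

open LargestPrimeFactorCubic CubicPrimes

/-! ### The windows as filters of `primesLE` -/

/-- `𝒦 = {X^{3δ} < p ≤ X^{4δ}}` in window form. [cite: HeathBrown2001LargestPrimeFactorCubic, (2.4)] -/
theorem kPrimes_eq_window (X : ℕ) :
    kPrimes X = (Nat.primesLE ⌊(X : ℝ) ^ (4 * hbδ)⌋₊).filter (fun p : ℕ => (X : ℝ) ^ (3 * hbδ) < (p : ℝ)) := by
  rw [kPrimes]
  ext p
  rw [mem_filter, mem_Ioc, mem_filter, Nat.mem_primesLE, Nat.floor_lt (by positivity)]
  tauto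

/-- `q1Range` in window form (`N = Npar X`). [cite: HeathBrown2001LargestPrimeFactorCubic, (2.17)] -/
theorem q1Range_eq_window (X : ℕ) :
    q1Range X = (Nat.primesLE ⌊Npar X ^ ((5 : ℝ) / 7 + hbδ)⌋₊).filter (fun q : ℕ => Npar X ^ ((5 : ℝ) / 7) < (q : ℝ)) := by
  have h0 := Npar_nonneg X
  rw [q1Range]
  ext p
  rw [mem_filter, mem_Ioc, mem_filter, Nat.mem_primesLE, Nat.floor_lt (by positivity)]
  tauto

/-- `q2Range` in window form. [cite: HeathBrown2001LargestPrimeFactorCubic, (2.17)] -/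
theorem q2Range_eq_window (X : ℕ) :
    q2Range X = (Nat.primesLE ⌊Npar X ^ ((6 : ℝ) / 7 + hbδ)⌋₊).filter (fun q : ℕ => Npar X ^ ((6 : ℝ) / 7) < (q : ℝ)) := by
  have h0 := Npar_nonneg X
  rw [q2Range]
  ext p
  rw [mem_filter, mem_Ioc, mem_filter, Nat.mem_primesLE, Nat.floor_lt (by positivity)]
  tauto

/-! ### The limits along `X → ∞` -/

/-- `N = X^{(1+2δ)/3} → ∞`. [folklore] -/
theorem tendsto_Npar : Tendsto (fun X : ℕ => Npar X) atTop atTop := by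
  have hδ := hbδ_pos
  have h := (tendsto_rpow_atTop (by positivity : (0 : ℝ) < (1 + 2 * hbδ) / 3)).comp tendsto_natCast_atTop_atTop
  refine h.congr fun X => ?_
  simp [Npar, Function.comp]

/-- **(6.3)**: `∑_{p ∈ 𝒦} g(p)/p → log 4/3`. [cite: HeathBrown2001LargestPrimeFactorCubic, (6.3)] -/
theorem tendsto_sum_kPrimes :
    Tendsto (fun X : ℕ => ∑ p ∈ kPrimes X, (cubeRootTwoCount p : ℝ) / p) atTop (𝓝 (Real.log (4 / 3))) := by
  have h := (tendsto_sum_g_window_63 hbδ_pos).comp tendsto_natCast_atTop_atTop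
  refine h.congr fun X => ?_
  simp only [Function.comp, kPrimes_eq_window]

/-- **`∑_{q₁,q₂} ν(q₁)ν(q₂)/(q₁q₂) → L(δ)`** with `ν(p)/p = g(p)/(p+1)`, `δ = 1/321`.
[cite: HeathBrown2001LargestPrimeFactorCubic, §8 p. 31 and Lemma 8] -/
theorem tendsto_L_ranges :
    Tendsto (fun X : ℕ =>
      (∑ q ∈ q1Range X, (cubeRootTwoCount q : ℝ) / (q + 1)) *
        ∑ q ∈ q2Range X, (cubeRootTwoCount q : ℝ) / (q + 1)) atTop
      (𝓝 (Real.log (1 + 7 * hbδ / 5) * Real.log (1 + 7 * hbδ / 6))) := by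
  have h := (tendsto_L hbδ_pos).comp tendsto_Npar
  refine h.congr fun X => ?_
  simp only [Function.comp, q1Range_eq_window, q2Range_eq_window]

end Literature.NumberTheory.Sieve.HeathBrown2001
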